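import Mathlib
import Summits.HodgeConjecture.HodgeConjecture.Theorems.TropicalWeilObstructionGenericWeilPeriod

/-!
# Route `TropicalWeilObstruction` (Kontsevich's tropical test — NEGATION SINK, exploration, no summit claim):
# very general tropical Weil FOURFOLD periods (`n = 2`) and Weil-generic periods near a rational period

Negation-sink bookkeeping of the cell `pub-hodge-tropical` (seat tropical-2 gen 7): the `n = 2` twin of the support item
`GenericWeilPeriod` (stmt-HodgeConjecture-18481, `n = 4`, p`tropicalWeilObstruction_genericWeilPeriod_proof`), needed by the
`n = 2` CALIBRATION of the crux K1 (`TropicalWeilVanishing`, stmt-HodgeConjecture-18478): the dimension `2n = 4` is the one where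
Weil classes are known to be algebraic (Schoen 1988; Markman 2025 for all Weil fourfolds), so the tropical method must — and, by the
companion files, does — produce effective tropical `2`-cycles with non-zero Weil functional at very general tropical Weil fourfold periods.

* `genericWeilPeriod_two` — there is a positive definite real `4 × 4` matrix `Q` commuting with `J = weilJ 2` (`J e_k = e_{k+2}`) whose
  `4` free entries (`weilFreeIndex 2`) are algebraically independent over `ℚ` (same proof as for `n = 4`: transcendence degree of `ℝ/ℚ`,
  affine rational substitutions, `xᵀ(1+E)x ≥ ‖x‖²/2` for `|E_ab| ≤ 1/8`).
* `exists_weilGeneric_two_mem_of_open` — every open set of `4 × 4` matrices containing a positive definite `J`-commuting matrix `Q₀` with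
  RATIONAL entries contains a Weil-generic positive definite `J`-commuting period (the segment from `Q₀` to the witness: convex combinations of
  positive definite matrices are positive definite; rational affine substitutions preserve algebraic independence).

HONEST STATUS. Elementary; decides nothing about K1 (an OPEN problem, `n = 4`) or about the Hodge conjecture. No definition, no named fact,
no sorry. References: [Zharkov2020TropicalWeil] I. Zharkov, arXiv:2002.02347, §2 (pp. 2–4) (the tropical Weil family, `n = 2`).
-/

set_option linter.dupNamespace false

noncomputable section

open scoped BigOperators Matrix Topology
open Matrix Literature.AlgebraicGeometry.Tropical

namespace Summit.HodgeConjecture.HodgeConjecture.Theorems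

namespace GenericWeilPeriodTwo

open GenericWeilPeriod

/-! ### Block matrices `[[A, B], [-B, A]]` on `Fin 4 = Fin 2 ⊕ Fin 2` and `J = weilJ 2` -/

/-- `J = weilJ 2` in block form `[[0, -1], [1, 0]]` on `Fin 2 ⊕ Fin 2`. [cite: Zharkov2020TropicalWeil, §2 (pp. 2–4)] -/
theorem weilJ_two_eq :
    (weilJ 2 : Matrix (Fin 4) (Fin 4) ℝ) =
      Matrix.reindex (finSumFinEquiv (m := 2) (n := 2)) (finSumFinEquiv (m := 2) (n := 2))
        (Matrix.fromBlocks (0 : Matrix (Fin 2) (Fin 2) ℝ) (-1) 1 0) := by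
  ext a b
  obtain ⟨u, rfl⟩ := (finSumFinEquiv (m := 2) (n := 2)).surjective a
  obtain ⟨v, rfl⟩ := (finSumFinEquiv (m := 2) (n := 2)).surjective b
  simp only [Matrix.reindex_apply, Matrix.submatrix_apply, Equiv.symm_apply_apply, weilJ]
  rcases u with i | i <;> rcases v with j | j
  all_goals
    have hi := i.isLt
    have hj := j.isLt
    simp only [finSumFinEquiv_apply_left, finSumFinEquiv_apply_right, Fin.val_castAdd,
      Fin.val_natAdd, Matrix.fromBlocks_apply₁₁, Matrix.fromBlocks_apply₁₂,
      Matrix.fromBlocks_apply₂₁, Matrix.fromBlocks_apply₂₂, Matrix.zero_apply, Matrix.neg_apply,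
      Matrix.one_apply, Fin.ext_iff]
    split_ifs <;> first | rfl | (exfalso; omega) | simp

/-- Block matrices `[[A, B], [-B, A]]` commute with `J = weilJ 2`. [cite: Zharkov2020TropicalWeil, §2 (pp. 2–4)] -/
theorem blocks_mul_weilJ (A B : Matrix (Fin 2) (Fin 2) ℝ) :
    Matrix.reindex (finSumFinEquiv (m := 2) (n := 2)) (finSumFinEquiv (m := 2) (n := 2))
        (Matrix.fromBlocks A B (-B) A) * (weilJ 2 : Matrix (Fin 4) (Fin 4) ℝ) =
      (weilJ 2 : Matrix (Fin 4) (Fin 4) ℝ) *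
        Matrix.reindex (finSumFinEquiv (m := 2) (n := 2)) (finSumFinEquiv (m := 2) (n := 2))
          (Matrix.fromBlocks A B (-B) A) := by
  rw [weilJ_two_eq, Matrix.reindex_apply, Matrix.reindex_apply, Matrix.submatrix_mul_equiv,
    Matrix.submatrix_mul_equiv, Matrix.fromBlocks_multiply, Matrix.fromBlocks_multiply]
  simp

/-- `[[A, B], [-B, A]]` is symmetric when `Aᵀ = A` and `Bᵀ = -B`. [folklore] -/
theorem blocks_transpose (A B : Matrix (Fin 2) (Fin 2) ℝ) (hA : Aᵀ = A) (hB : Bᵀ = -B) :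
    (Matrix.reindex (finSumFinEquiv (m := 2) (n := 2)) (finSumFinEquiv (m := 2) (n := 2))
        (Matrix.fromBlocks A B (-B) A))ᵀ =
      Matrix.reindex (finSumFinEquiv (m := 2) (n := 2)) (finSumFinEquiv (m := 2) (n := 2))
        (Matrix.fromBlocks A B (-B) A) := by
  rw [Matrix.transpose_reindex, Matrix.fromBlocks_transpose, hA, Matrix.transpose_neg, hB, neg_neg]

/-- Entries of `[[A, B], [-B, A]]` are bounded by a common bound of the entries of `A` and `B`. [folklore] -/
theorem abs_blocks_apply_le (A B : Matrix (Fin 2) (Fin 2) ℝ) {δ : ℝ} (hA : ∀ i j, |A i j| ≤ δ)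
    (hB : ∀ i j, |B i j| ≤ δ) (a b : Fin 4) :
    |Matrix.reindex (finSumFinEquiv (m := 2) (n := 2)) (finSumFinEquiv (m := 2) (n := 2))
        (Matrix.fromBlocks A B (-B) A) a b| ≤ δ := by
  simp only [Matrix.reindex_apply, Matrix.submatrix_apply]
  rcases (finSumFinEquiv (m := 2) (n := 2)).symm a with i | i <;>
    rcases (finSumFinEquiv (m := 2) (n := 2)).symm b with j | j
  · simpa using hA i j
  · simpa using hB i j
  · simpa [abs_neg] using hB i j
  · simpa using hA i j

/-! ### Positivity of a small symmetric perturbation of the identity -/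

/-- If `E` is a symmetric real `4 × 4` matrix with `|E_ab| ≤ 1/8`, then `1 + E` is positive definite:
`xᵀ(1 + E)x ≥ Σ x_a² - (1/8)(Σ |x_a|)² ≥ Σ x_a² / 2`. [folklore] -/
theorem posDef_one_add {E : Matrix (Fin 4) (Fin 4) ℝ} (hsymm : Eᵀ = E)
    (hE : ∀ a b, |E a b| ≤ 1 / 8) : (1 + E).PosDef := by
  refine Matrix.PosDef.of_dotProduct_mulVec_pos ?_ fun x hx => ?_
  · rw [Matrix.IsHermitian, Matrix.conjTranspose_eq_transpose_of_trivial, Matrix.transpose_add,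
      Matrix.transpose_one, hsymm]
  · have hquad : dotProduct (star x) ((1 + E) *ᵥ x) = ∑ a, x a ^ 2 + ∑ a, ∑ b, E a b * (x a * x b) := by
      rw [star_trivial, Matrix.add_mulVec, Matrix.one_mulVec, dotProduct_add]
      congr 1
      · simp [dotProduct, sq]
      · simp only [dotProduct, Matrix.mulVec, Finset.mul_sum]
        exact Finset.sum_congr rfl fun a _ => Finset.sum_congr rfl fun b _ => by ring
    have hbound : |∑ a, ∑ b, E a b * (x a * x b)| ≤ (1 / 8) * (∑ a, |x a|) ^ 2 := by
      calc |∑ a, ∑ b, E a b * (x a * x b)|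
          ≤ ∑ a, |∑ b, E a b * (x a * x b)| := Finset.abs_sum_le_sum_abs _ _
        _ ≤ ∑ a, ∑ b, |E a b * (x a * x b)| :=
            Finset.sum_le_sum fun a _ => Finset.abs_sum_le_sum_abs _ _
        _ ≤ ∑ a, ∑ b, (1 / 8) * (|x a| * |x b|) :=
            Finset.sum_le_sum fun a _ => Finset.sum_le_sum fun b _ => by
              rw [abs_mul, abs_mul]
              exact mul_le_mul_of_nonneg_right (hE a b) (by positivity)
        _ = (1 / 8) * (∑ a, |x a|) ^ 2 := by
            rw [sq, Finset.sum_mul_sum, Finset.mul_sum]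
            exact Finset.sum_congr rfl fun a _ => by rw [Finset.mul_sum]
    have hcs : (∑ a, |x a|) ^ 2 ≤ 4 * ∑ a, x a ^ 2 := by
      have h := sq_sum_le_card_mul_sum_sq (s := (Finset.univ : Finset (Fin 4))) (f := fun a => |x a|)
      simp only [Finset.card_univ, Fintype.card_fin, Nat.cast_ofNat, sq_abs] at h
      exact h
    have hpos : 0 < ∑ a, x a ^ 2 := by
      obtain ⟨a, ha⟩ : ∃ a, x a ≠ 0 := Function.ne_iff.mp hx
      exact Finset.sum_pos' (fun b _ => sq_nonneg (x b)) ⟨a, Finset.mem_univ a, by positivity⟩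
    rw [hquad]
    have := neg_le_of_abs_le hbound
    nlinarith

/-! ### The witness -/

/-- For every assignment `y` of the 4 free coordinates with `|y_k| ≤ 1/8` there is a symmetric `E` with `|E_ab| ≤ 1/8`, `E J = J E`,
and free entries of `1 + E` equal to `y_{(a,b)} + 1_{a = b}`: `E = [[A₀, B], [-B, A₀]]`, `A₀` symmetric with upper triangle
`y_{(i,j)}`, `B` antisymmetric with strict upper triangle `y_{(i, j+2)}`. [cite: Zharkov2020TropicalWeil, §2 (pp. 2–4)] -/
theorem exists_perturbation (y : weilFreeIndex 2 → ℝ) (hy : ∀ k, |y k| ≤ 1 / 8) :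
    ∃ E : Matrix (Fin 4) (Fin 4) ℝ, Eᵀ = E ∧ (∀ a b, |E a b| ≤ 1 / 8) ∧
      E * (weilJ 2 : Matrix (Fin 4) (Fin 4) ℝ) = (weilJ 2 : Matrix (Fin 4) (Fin 4) ℝ) * E ∧
      ∀ ab : weilFreeIndex 2, (1 + E) ab.1.1 ab.1.2 =
        ((1 : ℚ) : ℝ) * y ab + ((if ab.1.1 = ab.1.2 then 1 else 0 : ℚ) : ℝ) := by
  -- total extension of `y` by zero to all pairs of naturals
  obtain ⟨z, hz, hzb⟩ : ∃ z : ℕ → ℕ → ℝ,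
      (∀ ab : weilFreeIndex 2, z ab.1.1 ab.1.2 = y ab) ∧ ∀ a b, |z a b| ≤ 1 / 8 := by
    classical
    refine ⟨fun a b => if h : a < 2 * 2 ∧ b < 2 * 2 ∧ (a ≤ b ∧ (b < 2 ∨ (a < 2 ∧ a + 2 < b))) then
        y ⟨(⟨a, h.1⟩, ⟨b, h.2.1⟩), h.2.2⟩ else 0, fun ab => ?_, fun a b => ?_⟩
    · obtain ⟨⟨a, b⟩, hab⟩ := ab
      have h : (a : ℕ) < 2 * 2 ∧ (b : ℕ) < 2 * 2 ∧
          ((a : ℕ) ≤ b ∧ ((b : ℕ) < 2 ∨ ((a : ℕ) < 2 ∧ (a : ℕ) + 2 < b))) := ⟨a.2, b.2, hab⟩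
      simp only [dif_pos h]
    · simp only
      split_ifs
      · exact hy _
      · norm_num
  -- the blocks
  obtain ⟨A, hA⟩ : ∃ A : Matrix (Fin 2) (Fin 2) ℝ,
      A = Matrix.of fun i j : Fin 2 => if (i : ℕ) ≤ j then z i j else z j i := ⟨_, rfl⟩
  obtain ⟨B, hB⟩ : ∃ B : Matrix (Fin 2) (Fin 2) ℝ, B = Matrix.of fun i j : Fin 2 =>
      if (i : ℕ) < j then z i (j + 2) else if (j : ℕ) < i then -z j (i + 2) else 0 := ⟨_, rfl⟩
  have hAt : Aᵀ = A := by
    ext i j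
    simp only [hA, Matrix.transpose_apply, Matrix.of_apply]
    rcases lt_trichotomy (i : ℕ) j with h | h | h
    · rw [if_neg (not_le_of_gt h), if_pos h.le]
    · simp [h]
    · rw [if_pos h.le, if_neg (not_le_of_gt h)]
  have hBt : Bᵀ = -B := by
    ext i j
    simp only [hB, Matrix.transpose_apply, Matrix.of_apply, Matrix.neg_apply]
    rcases lt_trichotomy (i : ℕ) j with h | h | h
    · rw [if_neg (lt_asymm h), if_pos h, if_pos h]
    · simp [h]
    · rw [if_pos h, if_neg (lt_asymm h), if_pos h, neg_neg]
  have hAb : ∀ i j, |A i j| ≤ 1 / 8 := fun i j => by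
    simp only [hA, Matrix.of_apply]
    split_ifs <;> exact hzb _ _
  have hBb : ∀ i j, |B i j| ≤ 1 / 8 := fun i j => by
    simp only [hB, Matrix.of_apply]
    split_ifs
    · exact hzb _ _
    · rw [abs_neg]; exact hzb _ _
    · norm_num
  refine ⟨Matrix.reindex (finSumFinEquiv (m := 2) (n := 2)) (finSumFinEquiv (m := 2) (n := 2))
      (Matrix.fromBlocks A B (-B) A), blocks_transpose A B hAt hBt, abs_blocks_apply_le A B hAb hBb,
    blocks_mul_weilJ A B, fun ab => ?_⟩
  -- the free entries
  obtain ⟨⟨a, b⟩, hab⟩ := ab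
  have hfree : (a : ℕ) ≤ b ∧ ((b : ℕ) < 2 ∨ ((a : ℕ) < 2 ∧ (a : ℕ) + 2 < b)) := hab
  have hz' : z a b = y ⟨(a, b), hab⟩ := hz ⟨(a, b), hab⟩
  show (1 + Matrix.reindex (finSumFinEquiv (m := 2) (n := 2)) (finSumFinEquiv (m := 2) (n := 2))
      (Matrix.fromBlocks A B (-B) A)) a b =
    ((1 : ℚ) : ℝ) * y ⟨(a, b), hab⟩ + ((if a = b then 1 else 0 : ℚ) : ℝ)
  rw [Matrix.add_apply, Matrix.one_apply, Rat.cast_one, one_mul, add_comm, ← hz']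
  congr 1
  · simp only [Matrix.reindex_apply, Matrix.submatrix_apply]
    have ha4 : (a : ℕ) < 2 := by omega
    have hsa : (finSumFinEquiv (m := 2) (n := 2)).symm a = Sum.inl (⟨a, ha4⟩ : Fin 2) := by
      have : a = Fin.castAdd 2 (⟨a, ha4⟩ : Fin 2) := Fin.ext rfl
      conv_lhs => rw [this]
      exact finSumFinEquiv_symm_apply_castAdd _
    rcases hfree.2 with hb4 | ⟨-, hb5⟩
    · have hsb : (finSumFinEquiv (m := 2) (n := 2)).symm b = Sum.inl (⟨b, hb4⟩ : Fin 2) := by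
        have : b = Fin.castAdd 2 (⟨b, hb4⟩ : Fin 2) := Fin.ext rfl
        conv_lhs => rw [this]
        exact finSumFinEquiv_symm_apply_castAdd _
      rw [hsa, hsb, Matrix.fromBlocks_apply₁₁]
      simp only [hA, Matrix.of_apply]
      rw [if_pos hfree.1]
    · have hb4 : (b : ℕ) - 2 < 2 := by omega
      have hsb : (finSumFinEquiv (m := 2) (n := 2)).symm b =
          Sum.inr (⟨(b : ℕ) - 2, hb4⟩ : Fin 2) := by
        have : b = Fin.natAdd 2 (⟨(b : ℕ) - 2, hb4⟩ : Fin 2) :=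
          Fin.ext (by simp only [Fin.val_natAdd]; omega)
        conv_lhs => rw [this]
        exact finSumFinEquiv_symm_apply_natAdd _
      rw [hsa, hsb, Matrix.fromBlocks_apply₁₂]
      simp only [hB, Matrix.of_apply]
      rw [if_pos (show (a : ℕ) < (b : ℕ) - 2 by omega),
        show (b : ℕ) - 2 + 2 = (b : ℕ) by omega]
  · split_ifs <;> simp

/-- **Very general tropical Weil FOURFOLD periods exist**: there is a positive definite real `4 × 4` matrix `Q` with `Q J = J Q`
(`J = weilJ 2`) whose `4` free entries `weilFreeIndex 2` are algebraically independent over `ℚ` (witness `Q = 1 + E`).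
[cite: Zharkov2020TropicalWeil, §2 (pp. 2–4)] -/
theorem genericWeilPeriod_two :
    ∃ Q : Matrix (Fin (2 * 2)) (Fin (2 * 2)) ℝ, Q.PosDef ∧ Q * weilJ 2 = weilJ 2 * Q ∧ IsWeilGeneric 2 Q := by
  haveI : Finite (weilFreeIndex 2) := by unfold weilFreeIndex; infer_instance
  obtain ⟨y, hy, hsmall⟩ :=
    exists_algebraicIndependent_real_small (weilFreeIndex 2) (δ := 1 / 8) (by norm_num)
  obtain ⟨E, hEt, hEb, hEJ, hfree⟩ := exists_perturbation y hsmall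
  refine ⟨1 + E, ?_, ?_, ?_⟩
  · exact posDef_one_add hEt hEb
  · rw [add_mul, mul_add, one_mul, mul_one]
    exact congrArg _ hEJ
  · unfold IsWeilGeneric
    have h := algebraicIndependent_affine hy (fun _ => 1)
      (fun ab => if ab.1.1 = ab.1.2 then 1 else 0) (fun _ => one_ne_zero)
    convert h using 1
    funext ab
    exact hfree ab

/-! ### Weil-generic periods accumulate at every rational positive definite `J`-commuting period -/

/-- **Weil-generic periods near a rational period (`n = 2`).** Every open set of `4 × 4` real matrices containing a positive definite
`J`-commuting `Q₀` with rational entries contains a positive definite `Q` commuting with `J = weilJ 2` whose free coordinates are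
algebraically independent over `ℚ` (the segment from `Q₀` to the witness of `genericWeilPeriod_two`, at a small rational parameter).
[cite: Zharkov2020TropicalWeil, §2 (pp. 2–4)] -/
theorem exists_weilGeneric_two_mem_of_open (Q₀ : Matrix (Fin (2 * 2)) (Fin (2 * 2)) ℝ)
    (hrat : ∃ q : Fin (2 * 2) → Fin (2 * 2) → ℚ, ∀ a b, Q₀ a b = (q a b : ℝ))
    (hQ₀ : Q₀.PosDef) (hQ₀J : Q₀ * weilJ 2 = weilJ 2 * Q₀)
    (U : Set (Matrix (Fin (2 * 2)) (Fin (2 * 2)) ℝ)) (hU : IsOpen U) (h0 : Q₀ ∈ U) :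
    ∃ Q ∈ U, Q.PosDef ∧ Q * weilJ 2 = weilJ 2 * Q ∧ IsWeilGeneric 2 Q := by
  obtain ⟨Q₁, hQ₁, hQ₁J, hgen⟩ := genericWeilPeriod_two
  obtain ⟨q, hq⟩ := hrat
  -- the segment `t ↦ Q₀ + t (Q₁ - Q₀)` is continuous and starts in `U`
  have hcont : Continuous fun t : ℝ => Q₀ + t • (Q₁ - Q₀) :=
    continuous_const.add (continuous_id.smul continuous_const)
  have hev : ∀ᶠ t in 𝓝 (0 : ℝ), Q₀ + t • (Q₁ - Q₀) ∈ U := by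
    apply hcont.continuousAt.eventually_mem
    apply hU.mem_nhds
    simpa using h0
  obtain ⟨δ, hδ, hball⟩ := Metric.eventually_nhds_iff.1 hev
  -- a rational parameter `0 < t < min δ 1`
  obtain ⟨t, ht0, ht1⟩ := exists_rat_btwn (lt_min hδ one_pos)
  have ht0' : (0 : ℝ) < t := by exact_mod_cast ht0
  have htδ : (t : ℝ) < δ := lt_of_lt_of_le ht1 (min_le_left _ _)
  have ht1' : (t : ℝ) < 1 := lt_of_lt_of_le ht1 (min_le_right _ _)
  have hdist : dist (t : ℝ) 0 < δ := by rw [Real.dist_eq, sub_zero, abs_of_pos ht0']; exact htδ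
  refine ⟨Q₀ + (t : ℝ) • (Q₁ - Q₀), hball hdist, ?_, ?_, ?_⟩
  · -- convex combination of positive definite matrices
    have e : Q₀ + (t : ℝ) • (Q₁ - Q₀) = (1 - (t : ℝ)) • Q₀ + (t : ℝ) • Q₁ := by
      rw [smul_sub, sub_smul, one_smul]; abel
    rw [e]
    exact (hQ₀.smul (show (0 : ℝ) < 1 - t by linarith)).add (hQ₁.smul ht0')
  · rw [add_mul, mul_add, Matrix.smul_mul, Matrix.mul_smul, sub_mul, mul_sub, hQ₀J, hQ₁J]
  · -- free entries: `(1 - t) q_{ab} + t (Q₁)_{ab}` — an affine rational image of the free entries of `Q₁`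
    unfold IsWeilGeneric at hgen ⊢
    have h := algebraicIndependent_affine hgen (fun _ => t)
      (fun ab => (1 - t) * q ab.1.1 ab.1.2) (fun _ => by exact_mod_cast ht0.ne')
    convert h using 1
    funext ab
    simp only [Matrix.add_apply, Matrix.smul_apply, Matrix.sub_apply, smul_eq_mul, hq, Rat.cast_mul,
      Rat.cast_sub, Rat.cast_one]
    ring

end GenericWeilPeriodTwo

end Summit.HodgeConjecture.HodgeConjecture.Theorems

end
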